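import Literature.Analysis.ValidatedNumerics.ParametricLyapunovTaylorCertificate
import Literature.LinearAlgebra.Matrix.HermitianFamilyInertia
import HarnessLib

/-!
# Inertia leaves certified AT THE CENTRE: eigenvalue counts in the open half-planes on a box

Topic `Literature/Analysis/ValidatedNumerics`. Completion of the «inertia leaves» of
`ParametricLyapunovTaylorCertificate.lean` (certnum eigen-margin call, design note
`run/shared/lean/pub/certnum/sdp/DESIGN-eigopt.md` §1 S5). There, a leaf of the real affine family
`J(x) = J₀ + Σ_k x_k J^{(k)}` carries an indefinite matrix polynomial `P(δ)`, ONE certificate for the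
Lyapunov form `Q(δ) = J(x)ᵀ(−P(δ)) + (−P(δ))J(x) ⪰ m·1` (`m > 0`) on the leaf, and test tables `V`, `U`
whose compressions `VᵀP(δ)V ≺ O`, `UᵀP(δ)U ≻ O` were certified UNIFORMLY on the leaf through centred
interval families — an interval test which forces small leaves when the positive block is large.

THE POINT OF THIS FILE. By the Carlson–Schneider Main Inertia Theorem (tree theorem
`Literature.LinearAlgebra.Matrix.card_eigenvalues_eq_of_lyapunov_posDef`) `G(δ) = −P(δ)` has NO zero
eigenvalue wherever `Q(δ) ≻ O`, i.e. on the whole (convex) leaf; and the inertia of a continuous family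
of nonsingular Hermitian matrices is CONSTANT on a preconnected set (tree theorem
`Literature.LinearAlgebra.Matrix.card_pos_eigenvalues_eq_of_isPreconnected`, file
`HermitianFamilyInertia.lean`). Hence the counts need certifying AT THE CENTRE `δ = 0` ONLY, where
`P(0) = Σ_{α_i = 0} P_i` is exact rational data: this is the check `lyapInertiaLeafOKC` (defined, with its
analytic core `lyapInertiaLeafOKC_core`, at the end of `ParametricLyapunovTaylorCertificate.lean`).

SOUNDNESS (`countP_re_of_lyapInertiaLeafOKC`, `countP_re_of_kdCheck_lyapInertiaC`,
`countP_re_of_kdCheck_lyapInertiaC_conj_shifted`, `exists_re_gt_neg_of_kdCheck_lyapInertiaC_conj_shifted`):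
for every `x` of the box, the characteristic polynomial of `J(x) + s·1` over `ℂ` has exactly `q` roots with
`Re > 0`, `n − q` with `Re < 0`, none with `Re = 0`; for `0 < q` an eigenvalue of `J(x)` with `Re μ > −s`.

## What is NOT certified

As for all inertia leaves: which eigenvalues (counts with algebraic multiplicity only); boxes meeting a
crossing of the line `Re = −s` (the tree fails there); anything dynamical beyond the linearisation.

## References

* [CarlsonSchneider1962] D. Carlson, H. Schneider, *Inertia theorems for matrices: the semi-definite case*,
  Bull. Amer. Math. Soc. 68 (1962) 479–484, § 1 (Main Inertia Theorem). [cite: CarlsonSchneider1962, § 1]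
* [GolubVanLoan2013] G. H. Golub, C. F. Van Loan, *Matrix Computations*, 4th ed., §8.1.1 Thm 8.1.2
  (Courant–Fischer Minimax Theorem; the minimax count).
  [cite: GolubVanLoan2013, §8.1.1 Thm 8.1.2 (Courant–Fischer Minimax Theorem)]
* [Hladik2017] M. Hladík, arXiv:1704.05782, §3 (centred forms). [cite: Hladik2017, §3]
-/

open Finset Matrix

namespace Literature.Analysis.ValidatedNumerics

open ParametricIntervalPosSemidef ParametricEigenMargin Literature.LinearAlgebra.Matrix
open scoped ComplexOrder

/-! ### Part A. Plumbing re-derived here (continuity; shift and similarity of the characteristic polynomial) -/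

/-- Continuity of the monomial `δ ↦ δ^a`. [folklore] -/
private theorem continuous_monoR₇ {K : ℕ} (a : List ℕ) : Continuous fun δ : Fin K → ℝ ↦ monoR K δ a := by
  unfold monoR
  exact continuous_finsetProd _ fun k _ ↦ (continuous_apply k).pow _

/-- Continuity of the complexified negative leaf polynomial `δ ↦ (−P(δ))ℂ`. [folklore] -/
private theorem continuous_negPolyTab_map₇ (n N K : ℕ) (idx : List (List ℕ)) (Ts : List (List (List ℚ))) :
    Continuous fun δ : Fin K → ℝ ↦ (-polyTabR n N K idx Ts δ).map (algebraMap ℝ ℂ) := by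
  have h1 : Continuous (polyTabR n N K idx Ts) := by
    unfold polyTabR
    exact continuous_finsetSum _ fun _ _ ↦ (continuous_monoR₇ _).smul continuous_const
  exact (h1.neg).matrix_map (continuous_algebraMap ℝ ℂ)

/-- `(vtab K f).getD k d = f k` for `k < K`. [folklore] -/
private theorem vtab_getD₇ {β : Type*} {K : ℕ} (f : ℕ → β) (d : β) {k : ℕ} (hk : k < K) :
    (vtab K f).getD k d = f k := by
  unfold vtab
  rw [List.getD_eq_getElem?_getD, List.getElem?_map, List.getElem?_range hk]
  rfl

/-- `(M + s·1)ℂ = s + Mℂ` in the algebra `Matrix (Fin n) (Fin n) ℂ`. [folklore] -/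
private theorem map_add_smul_one₇ {n : ℕ} (M : Matrix (Fin n) (Fin n) ℝ) (s : ℚ) :
    (M + (s : ℝ) • (1 : Matrix (Fin n) (Fin n) ℝ)).map (algebraMap ℝ ℂ)
      = algebraMap ℂ (Matrix (Fin n) (Fin n) ℂ) (s : ℂ) + M.map (algebraMap ℝ ℂ) := by
  rw [Matrix.map_add (algebraMap ℝ ℂ) (map_add _), Algebra.algebraMap_eq_smul_one, add_comm]
  congr 1
  ext i j
  simp only [Matrix.map_apply, Matrix.smul_apply, Matrix.one_apply, smul_eq_mul, mul_ite, mul_one,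
    mul_zero]
  split_ifs <;> simp [Complex.coe_algebraMap]

/-- **Spectral shift for existence**: `q ≥ 1` characteristic roots of `(M + s·1)ℂ` with `Re > 0` give an
eigenvalue of `Mℂ` with `Re > −s`. [folklore] -/
private theorem exists_re_gt_neg_of_countP_shift₇ {n : ℕ} {M : Matrix (Fin n) (Fin n) ℝ} {s : ℚ} {q : ℕ}
    (hq : 0 < q)
    (h : q ≤ ((M + (s : ℝ) • (1 : Matrix (Fin n) (Fin n) ℝ)).map (algebraMap ℝ ℂ)).charpoly.roots.countP
      (fun μ ↦ 0 < μ.re)) :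
    ∃ μ ∈ spectrum ℂ (M.map (algebraMap ℝ ℂ)), -(s : ℝ) < μ.re := by
  obtain ⟨ν, hν, hre⟩ := Multiset.countP_pos.1 (lt_of_lt_of_le hq h)
  have hν' : ν ∈ spectrum ℂ ((M + (s : ℝ) • (1 : Matrix (Fin n) (Fin n) ℝ)).map (algebraMap ℝ ℂ)) :=
    (Matrix.mem_spectrum_iff_isRoot_charpoly).2 ((Polynomial.mem_roots (charpoly_monic _).ne_zero).1 hν)
  rw [map_add_smul_one₇, ← spectrum.singleton_add_eq] at hν'
  obtain ⟨a, ha, μ, hμ, hsum⟩ := Set.mem_add.1 hν'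
  rw [Set.mem_singleton_iff] at ha
  refine ⟨μ, hμ, ?_⟩
  have : ν.re = (s : ℝ) + μ.re := by rw [← hsum, ha, Complex.add_re, Complex.ratCast_re]
  linarith

/-- `finMat (J + s·1) = finMat J + s • 1`. [folklore] -/
private theorem finMat_addDiagTab₇ (n : ℕ) (s : ℚ) (J : List (List ℚ)) :
    finMat n (addDiagTab n s J) = finMat n J + (s : ℝ) • (1 : Matrix (Fin n) (Fin n) ℝ) := by
  ext i j
  rw [Matrix.add_apply, Matrix.smul_apply, Matrix.one_apply, smul_eq_mul]
  show ((mget (addDiagTab n s J) i j : ℚ) : ℝ) = ((mget J i j : ℚ) : ℝ) + _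
  unfold addDiagTab
  rw [mget_mtab _ i.isLt j.isLt]
  by_cases h : i = j
  · subst h; simp
  · have h' : (i : ℕ) ≠ (j : ℕ) := fun e ↦ h (Fin.ext e)
    simp [h, h']

/-- `finMat (D·J·D⁻¹) = diag(d) · finMat J · diag(d⁻¹)`. [folklore] -/
private theorem finMat_conjDiagTab₇ {n : ℕ} (d : List ℚ) (J : List (List ℚ)) :
    finMat n (conjDiagTab n d J)
      = Matrix.diagonal (fun i : Fin n ↦ (vreal d i)) * finMat n J
          * Matrix.diagonal (fun i : Fin n ↦ (vreal d i)⁻¹) := by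
  ext i j
  rw [Matrix.mul_diagonal, Matrix.diagonal_mul]
  show ((mget (conjDiagTab n d J) i j : ℚ) : ℝ) = _
  unfold conjDiagTab vreal
  rw [mget_mtab _ i.isLt j.isLt]; push_cast
  show _ = ((vget d i : ℚ) : ℝ) * ((mget J i j : ℚ) : ℝ) * (((vget d j : ℚ) : ℝ))⁻¹
  ring

/-- The balanced affine family is the conjugate of the original one. [folklore] -/
private theorem affine_conjDiagTab_eq₇ {n K : ℕ} (d : List ℚ) (J0 : List (List ℚ))
    (Js : List (List (List ℚ))) (x : ℕ → ℝ) :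
    finMat n (conjDiagTab n d J0)
        + paramMatrix (fun k : Fin K ↦ finMat n ((vtab K fun k ↦ conjDiagTab n d (Js.getD k [])).getD k []))
            (fun k : Fin K ↦ x k)
      = Matrix.diagonal (fun i : Fin n ↦ (vreal d i))
          * (finMat n J0 + paramMatrix (fun k : Fin K ↦ finMat n (Js.getD k [])) (fun k : Fin K ↦ x k))
          * Matrix.diagonal (fun i : Fin n ↦ (vreal d i)⁻¹) := by
  have h2 : ∀ k : Fin K, (vtab K fun k ↦ conjDiagTab n d (Js.getD k [])).getD k []
      = conjDiagTab n d (Js.getD k []) := fun k ↦ vtab_getD₇ _ _ k.isLt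
  simp only [h2, finMat_conjDiagTab₇]
  unfold paramMatrix
  rw [Matrix.mul_add, Matrix.add_mul, Matrix.mul_sum, Matrix.sum_mul]
  congr 1
  refine Finset.sum_congr rfl fun k _ ↦ ?_
  rw [Matrix.mul_smul, Matrix.smul_mul]

/-- Positive diagonal similarity preserves the characteristic polynomial (complexified). [folklore] -/
private theorem charpoly_conjDiag₇ {n : ℕ} {d : List ℚ} (hd : posListQ n d = true)
    (M : Matrix (Fin n) (Fin n) ℝ) :
    ((Matrix.diagonal (fun i : Fin n ↦ (vreal d i)) * M
      * Matrix.diagonal (fun i : Fin n ↦ (vreal d i)⁻¹)).map (algebraMap ℝ ℂ)).charpoly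
      = (M.map (algebraMap ℝ ℂ)).charpoly := by
  have hdpos : ∀ i : Fin n, (0 : ℝ) < vreal d i := fun i ↦ by
    have := of_rall hd i.isLt; rw [decide_eq_true_eq] at this
    unfold vreal; exact_mod_cast this
  let dc : Fin n → ℂ := fun i ↦ ((vreal d i : ℝ) : ℂ)
  have hdc : ∀ i, dc i ≠ 0 := fun i ↦ by
    simp only [dc, ne_eq, Complex.ofReal_eq_zero]; exact (hdpos i).ne'
  let u : (Matrix (Fin n) (Fin n) ℂ)ˣ :=
    ⟨Matrix.diagonal dc, Matrix.diagonal fun i ↦ (dc i)⁻¹,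
      by rw [Matrix.diagonal_mul_diagonal]; convert Matrix.diagonal_one with i; exact mul_inv_cancel₀ (hdc i),
      by rw [Matrix.diagonal_mul_diagonal]; convert Matrix.diagonal_one with i; exact inv_mul_cancel₀ (hdc i)⟩
  have hconj : (Matrix.diagonal (fun i : Fin n ↦ (vreal d i)) * M
        * Matrix.diagonal (fun i : Fin n ↦ (vreal d i)⁻¹)).map (algebraMap ℝ ℂ)
      = (u : Matrix (Fin n) (Fin n) ℂ) * M.map (algebraMap ℝ ℂ) * (u⁻¹ : (Matrix (Fin n) (Fin n) ℂ)ˣ) := by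
    rw [Matrix.map_mul, Matrix.map_mul]
    have e1 : (Matrix.diagonal fun i : Fin n ↦ vreal d i).map (algebraMap ℝ ℂ) = Matrix.diagonal dc :=
      Matrix.diagonal_map (map_zero _)
    have e2 : (Matrix.diagonal fun i : Fin n ↦ (vreal d i)⁻¹).map (algebraMap ℝ ℂ)
        = Matrix.diagonal fun i ↦ (dc i)⁻¹ := by
      rw [Matrix.diagonal_map (map_zero _)]
      congr 1; funext i; simp [dc, Complex.coe_algebraMap]
    rw [e1, e2]; rfl
  rw [hconj, Matrix.coe_units_inv]
  exact Matrix.charpoly_units_conj u _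

/-- `D M D⁻¹ + s·1 = D (M + s·1) D⁻¹` for a positive diagonal `D`. [folklore] -/
private theorem conjDiag_add_smul_one₇ {n : ℕ} {d : List ℚ} (hd : posListQ n d = true)
    (M : Matrix (Fin n) (Fin n) ℝ) (s : ℝ) :
    Matrix.diagonal (fun i : Fin n ↦ (vreal d i)) * M * Matrix.diagonal (fun i : Fin n ↦ (vreal d i)⁻¹)
        + s • (1 : Matrix (Fin n) (Fin n) ℝ)
      = Matrix.diagonal (fun i : Fin n ↦ (vreal d i)) * (M + s • (1 : Matrix (Fin n) (Fin n) ℝ))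
        * Matrix.diagonal (fun i : Fin n ↦ (vreal d i)⁻¹) := by
  have hdpos : ∀ i : Fin n, (0 : ℝ) < vreal d i := fun i ↦ by
    have := of_rall hd i.isLt; rw [decide_eq_true_eq] at this
    unfold vreal; exact_mod_cast this
  have hDD : Matrix.diagonal (fun i : Fin n ↦ (vreal d i)) * Matrix.diagonal (fun i : Fin n ↦ (vreal d i)⁻¹)
      = 1 := by
    rw [Matrix.diagonal_mul_diagonal, ← Matrix.diagonal_one]
    congr 1; funext i; exact mul_inv_cancel₀ (hdpos i).ne'
  rw [Matrix.mul_add, Matrix.add_mul, Matrix.mul_smul, Matrix.smul_mul, Matrix.mul_one, hDD]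

/-- The characteristic polynomial of the balanced + shifted family member is that of `J(x) + s·1`.
[folklore] -/
private theorem charpoly_conj_shifted_family₇ {n K : ℕ} {d : List ℚ} (hd : posListQ n d = true)
    (J0 : List (List ℚ)) (Js : List (List (List ℚ))) (s : ℚ) (x : ℕ → ℝ) :
    ((finMat n (addDiagTab n s (conjDiagTab n d J0))
        + paramMatrix (fun k : Fin K ↦ finMat n ((vtab K fun k ↦ conjDiagTab n d (Js.getD k [])).getD k []))
          (fun k : Fin K ↦ x k)).map (algebraMap ℝ ℂ)).charpoly
      = ((finMat n J0 + paramMatrix (fun k : Fin K ↦ finMat n (Js.getD k [])) (fun k : Fin K ↦ x k)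
          + (s : ℝ) • (1 : Matrix (Fin n) (Fin n) ℝ)).map (algebraMap ℝ ℂ)).charpoly := by
  rw [finMat_addDiagTab₇, add_right_comm, affine_conjDiagTab_eq₇, conjDiag_add_smul_one₇ hd,
    charpoly_conjDiag₇ hd]

/-- Trichotomy count on `Fin n`. [folklore] -/
private theorem card_trichotomy₇ {n : ℕ} (e : Fin n → ℝ) :
    #{i | 0 < e i} + #{i | e i < 0} + #{i | e i = 0} = n := by
  have h1 : #{i | 0 < e i} + #({i | ¬ 0 < e i} : Finset (Fin n)) = n := by
    rw [Finset.card_filter_add_card_filter_not, Finset.card_univ, Fintype.card_fin]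
  have h2 : #({i | ¬ 0 < e i} : Finset (Fin n)) = #{i | e i < 0} + #{i | e i = 0} := by
    rw [← Finset.card_union_of_disjoint]
    · congr 1
      ext i
      simp only [Finset.mem_filter, Finset.mem_univ, true_and, Finset.mem_union, not_lt]
      constructor
      · intro h; exact h.lt_or_eq
      · rintro (h | h); exact h.le; exact h.le
    · rw [Finset.disjoint_filter]
      intro i _ h1 h2
      rw [h2] at h1; exact lt_irrefl _ h1
  omega

/-! ### Part B. Soundness of the centre-only inertia leaves -/

/-- **Per leaf**: an accepted centre-only inertia leaf proves, at every point `x` of the leaf box, that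
the characteristic polynomial of `J(x)` over `ℂ` has EXACTLY `q` roots with `Re > 0`, exactly `n − q`
with `Re < 0` and none with `Re = 0` (algebraic multiplicity). Proof: `lyapInertiaLeafOKC_core` gives
the counts `≥ q`, `≥ n − q` at the centre and the Lyapunov form on the whole convex leaf; the Main Inertia
Theorem makes `G(δ) = (−P(δ))ℂ` nonsingular there, `card_pos_eigenvalues_eq_of_isPreconnected` transports
the centre's counts to `δ = x − c`, and the Main Inertia Theorem at `x` turns them into root counts.
[cite: CarlsonSchneider1962, § 1; GolubVanLoan2013, §8.1.1 Thm 8.1.2 (Courant–Fischer Minimax Theorem)] -/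
theorem countP_re_of_lyapInertiaLeafOKC {n K : ℕ} {J0 : List (List ℚ)} {Js : List (List (List ℚ))}
    {q : ℕ} {B : Box} {l : LyapInertiaLeaf} (h : lyapInertiaLeafOKC n K J0 Js q B l = true)
    (x : ℕ → ℝ) (hx : B.mem x) :
    ((finMat n J0 + paramMatrix (fun k : Fin K ↦ finMat n (Js.getD k [])) (fun k : Fin K ↦ x k)).map
        (algebraMap ℝ ℂ)).charpoly.roots.countP (fun μ ↦ 0 < μ.re) = q ∧
      ((finMat n J0 + paramMatrix (fun k : Fin K ↦ finMat n (Js.getD k [])) (fun k : Fin K ↦ x k)).map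
        (algebraMap ℝ ℂ)).charpoly.roots.countP (fun μ ↦ μ.re < 0) = n - q ∧
      ((finMat n J0 + paramMatrix (fun k : Fin K ↦ finMat n (Js.getD k [])) (fun k : Fin K ↦ x k)).map
        (algebraMap ℝ ℂ)).charpoly.roots.countP (fun μ ↦ μ.re = 0) = 0 := by
  obtain ⟨hG, hW, hqa, hqb⟩ := lyapInertiaLeafOKC_core h
  set L : ℕ := l.Ps.length with hL
  set wL : List ℚ := boxHalfList K B with hwL
  set cL : List ℚ := boxCentreList K B with hcL
  -- the centred leaf box, convex hence preconnected, contains `0` and `δx = x − c`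
  let S : Set (Fin K → ℝ) := Set.Icc (fun k ↦ -vreal wL k) (fun k ↦ vreal wL k)
  have hS : IsPreconnected S := (convex_Icc _ _).isPreconnected
  have hmemS : ∀ δ ∈ S, ∀ k : Fin K, |δ k| ≤ vreal wL k := fun δ hδ k ↦ abs_le.2 ⟨hδ.1 k, hδ.2 k⟩
  set δx : Fin K → ℝ := fun k ↦ x k - vreal cL k with hδx
  have hδabs : ∀ k : Fin K, |δx k| ≤ vreal wL k := fun k ↦ abs_sub_boxCentre_le hx k
  have hw0 : ∀ k : Fin K, 0 ≤ vreal wL k := fun k ↦ (abs_nonneg _).trans (hδabs k)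
  have hδS : δx ∈ S := ⟨fun k ↦ (abs_le.1 (hδabs k)).1, fun k ↦ (abs_le.1 (hδabs k)).2⟩
  have h0S : (fun _ : Fin K ↦ (0 : ℝ)) ∈ S := ⟨fun k ↦ by simpa using hw0 k, fun k ↦ hw0 k⟩
  -- the complexified family `G(δ) = (−P(δ))ℂ` is continuous and nonsingular on `S`
  have hGc : Continuous fun δ : Fin K → ℝ ↦ (-polyTabR n L K l.alphas l.Ps δ).map (algebraMap ℝ ℂ) :=
    continuous_negPolyTab_map₇ n L K l.alphas l.Ps
  have hzero : ∀ δ ∈ S, #{i | (hG δ).eigenvalues i = 0} = 0 := fun δ hδ ↦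
    (card_eigenvalues_eq_of_lyapunov_posDef (hG δ) (hW δ (hmemS δ hδ))).2.2
  have hconst := card_pos_eigenvalues_eq_of_isPreconnected hGc hG hS hzero h0S hδS
  -- counts at the centre
  have htri0 := card_trichotomy₇ (hG fun _ ↦ 0).eigenvalues
  have hz0 := hzero _ h0S
  have ha0 : #{i | 0 < (hG fun _ ↦ 0).eigenvalues i} = q := by omega
  have hb0 : #{i | (hG fun _ ↦ 0).eigenvalues i < 0} = n - q := by omega
  -- the Main Inertia Theorem at `x`
  have hJx : finMat n J0 + paramMatrix (fun k : Fin K ↦ finMat n (Js.getD k [])) (fun k : Fin K ↦ x k)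
      = finMat n (affineAtQ n K J0 Js cL) + paramMatrix (fun k : Fin K ↦ finMat n (Js.getD k [])) δx :=
    finMat_add_paramMatrix_eq_centre J0 Js B x
  have hWx := hW δx hδabs
  rw [← hJx] at hWx
  obtain ⟨hpos, hneg, -⟩ := card_eigenvalues_eq_of_lyapunov_posDef (hG δx) hWx
  refine ⟨?_, ?_, countP_re_eq_zero_of_lyapunov_posDef hWx⟩
  · rw [← hpos, ← hconst.1, ha0]
  · rw [← hneg, ← hconst.2, hb0]

/-- **Centre-only inertia certificate, box level (END-TO-END).** If a kd-tree of centre-only inertia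
leaves passes on the box `B`, then at EVERY point `x` of `B` the characteristic polynomial of `J(x)` over
`ℂ` has exactly `q` roots with `Re > 0`, exactly `n − q` with `Re < 0`, none with `Re = 0`.
[cite: CarlsonSchneider1962, § 1; GolubVanLoan2013, §8.1.1 Thm 8.1.2 (Courant–Fischer Minimax Theorem)] -/
theorem countP_re_of_kdCheck_lyapInertiaC {n K : ℕ} {J0 : List (List ℚ)}
    {Js : List (List (List ℚ))} {q : ℕ} {B : Box} {t : KdCert LyapInertiaLeaf}
    (h : t.check (lyapInertiaLeafOKC n K J0 Js q) B = true) (x : ℕ → ℝ) (hx : B.mem x) :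
    ((finMat n J0 + paramMatrix (fun k : Fin K ↦ finMat n (Js.getD k [])) (fun k : Fin K ↦ x k)).map
        (algebraMap ℝ ℂ)).charpoly.roots.countP (fun μ ↦ 0 < μ.re) = q ∧
      ((finMat n J0 + paramMatrix (fun k : Fin K ↦ finMat n (Js.getD k [])) (fun k : Fin K ↦ x k)).map
        (algebraMap ℝ ℂ)).charpoly.roots.countP (fun μ ↦ μ.re < 0) = n - q ∧
      ((finMat n J0 + paramMatrix (fun k : Fin K ↦ finMat n (Js.getD k [])) (fun k : Fin K ↦ x k)).map
        (algebraMap ℝ ℂ)).charpoly.roots.countP (fun μ ↦ μ.re = 0) = 0 :=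
  KdCert.sound (P := fun x ↦
      ((finMat n J0 + paramMatrix (fun k : Fin K ↦ finMat n (Js.getD k [])) (fun k : Fin K ↦ x k)).map
        (algebraMap ℝ ℂ)).charpoly.roots.countP (fun μ ↦ 0 < μ.re) = q ∧
      ((finMat n J0 + paramMatrix (fun k : Fin K ↦ finMat n (Js.getD k [])) (fun k : Fin K ↦ x k)).map
        (algebraMap ℝ ℂ)).charpoly.roots.countP (fun μ ↦ μ.re < 0) = n - q ∧
      ((finMat n J0 + paramMatrix (fun k : Fin K ↦ finMat n (Js.getD k [])) (fun k : Fin K ↦ x k)).map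
        (algebraMap ℝ ℂ)).charpoly.roots.countP (fun μ ↦ μ.re = 0) = 0)
    (fun _ _ hl x hx ↦ countP_re_of_lyapInertiaLeafOKC hl x hx) t B h x hx

/-- **Balanced + shifted centre-only inertia certificate (END-TO-END) ⇒ counts about the line
`Re = −s` for the ORIGINAL family**: with all scaling factors positive and the kd-tree checking for the
tables `(D J₀ D⁻¹ + s·1, D J^{(k)} D⁻¹)`, for every `x` in the box the characteristic polynomial of
`J(x) + s·1` over `ℂ` has exactly `q` roots with `Re > 0`, `n − q` with `Re < 0`, none with `Re = 0`.
[cite: CarlsonSchneider1962, § 1; GolubVanLoan2013, §8.1.1 Thm 8.1.2 (Courant–Fischer Minimax Theorem)] -/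
theorem countP_re_of_kdCheck_lyapInertiaC_conj_shifted {n K : ℕ} {J0 : List (List ℚ)}
    {Js : List (List (List ℚ))} {d : List ℚ} {s : ℚ} {q : ℕ} {B : Box} {t : KdCert LyapInertiaLeaf}
    (hd : posListQ n d = true)
    (h : t.check (lyapInertiaLeafOKC n K (addDiagTab n s (conjDiagTab n d J0))
      (vtab K fun k ↦ conjDiagTab n d (Js.getD k [])) q) B = true)
    (x : ℕ → ℝ) (hx : B.mem x) :
    ((finMat n J0 + paramMatrix (fun k : Fin K ↦ finMat n (Js.getD k [])) (fun k : Fin K ↦ x k)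
        + (s : ℝ) • (1 : Matrix (Fin n) (Fin n) ℝ)).map (algebraMap ℝ ℂ)).charpoly.roots.countP
        (fun μ ↦ 0 < μ.re) = q ∧
      ((finMat n J0 + paramMatrix (fun k : Fin K ↦ finMat n (Js.getD k [])) (fun k : Fin K ↦ x k)
        + (s : ℝ) • (1 : Matrix (Fin n) (Fin n) ℝ)).map (algebraMap ℝ ℂ)).charpoly.roots.countP
        (fun μ ↦ μ.re < 0) = n - q ∧
      ((finMat n J0 + paramMatrix (fun k : Fin K ↦ finMat n (Js.getD k [])) (fun k : Fin K ↦ x k)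
        + (s : ℝ) • (1 : Matrix (Fin n) (Fin n) ℝ)).map (algebraMap ℝ ℂ)).charpoly.roots.countP
        (fun μ ↦ μ.re = 0) = 0 := by
  rw [← charpoly_conj_shifted_family₇ hd J0 Js s x]
  exact countP_re_of_kdCheck_lyapInertiaC h x hx

/-- **The UPPER side of the spectral abscissa from a centre-only tree**: with `0 < q`, at every point
`x` of the box the ORIGINAL `J(x)` has an eigenvalue `μ` with `Re μ > −s` (and exactly `q` such, with
multiplicity). [cite: CarlsonSchneider1962, § 1] -/
theorem exists_re_gt_neg_of_kdCheck_lyapInertiaC_conj_shifted {n K : ℕ} {J0 : List (List ℚ)}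
    {Js : List (List (List ℚ))} {d : List ℚ} {s : ℚ} {q : ℕ} (hq : 0 < q) {B : Box}
    {t : KdCert LyapInertiaLeaf} (hd : posListQ n d = true)
    (h : t.check (lyapInertiaLeafOKC n K (addDiagTab n s (conjDiagTab n d J0))
      (vtab K fun k ↦ conjDiagTab n d (Js.getD k [])) q) B = true)
    (x : ℕ → ℝ) (hx : B.mem x) :
    ∃ μ ∈ spectrum ℂ ((finMat n J0 + paramMatrix (fun k : Fin K ↦ finMat n (Js.getD k []))
      (fun k : Fin K ↦ x k)).map (algebraMap ℝ ℂ)), -(s : ℝ) < μ.re :=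
  exists_re_gt_neg_of_countP_shift₇ hq (countP_re_of_kdCheck_lyapInertiaC_conj_shifted hd h x hx).1.ge

/-- The same existence statement from an EXACT interval-form tree (`lyapInertiaLeafOK` of the earlier
file): with `0 < q`, an eigenvalue `μ` of `J(x)` with `Re μ > −s` at every point of the box.
[cite: CarlsonSchneider1962, § 1] -/
theorem exists_re_gt_neg_of_kdCheck_lyapInertia_conj_shifted {n K : ℕ} {J0 : List (List ℚ)}
    {Js : List (List (List ℚ))} {d : List ℚ} {s : ℚ} {q : ℕ} (hq : 0 < q) {B : Box}
    {t : KdCert LyapInertiaLeaf} (hd : posListQ n d = true)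
    (h : t.check (lyapInertiaLeafOK n K (addDiagTab n s (conjDiagTab n d J0))
      (vtab K fun k ↦ conjDiagTab n d (Js.getD k [])) q) B = true)
    (x : ℕ → ℝ) (hx : B.mem x) :
    ∃ μ ∈ spectrum ℂ ((finMat n J0 + paramMatrix (fun k : Fin K ↦ finMat n (Js.getD k []))
      (fun k : Fin K ↦ x k)).map (algebraMap ℝ ℂ)), -(s : ℝ) < μ.re :=
  exists_re_gt_neg_of_countP_shift₇ hq (countP_re_of_kdCheck_lyapInertia_conj_shifted hd h x hx).1.ge

/-! ### Part C. Kernel example -/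

/-- The kernel example family `J(p) = [[1, p], [0, −1]]`, `p ∈ [−1, 1]`, with the centre-only check:
`P = diag(−1, 1)` (indefinite), `Q_0 = 2·1`, `Q_1 = [[0, 1], [1, 0]]`, test vectors `e₁`, `e₂` with the
EXACT compressions `−e₁ᵀPe₁ = 1`, `e₂ᵀPe₂ = 1`; claim `q = 1`. -/
example : KdCert.check (lyapInertiaLeafOKC 2 1 [[1, 0], [0, -1]] [[[0, 1], [0, 0]]] 1) [((-1 : ℚ), 1)]
    (KdCert.leaf ⟨[[0]], [[[-1, 0], [0, 1]]], [[0], [1]], ⟨1, 0, [], []⟩, [[1], [0]], ⟨1, 0, [], []⟩,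
      [[0], [1]], ⟨1, 0, [], []⟩⟩) = true := by
  decide +kernel

end Literature.Analysis.ValidatedNumerics
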